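import Summits.Schanuel.Schanuel.Theorems.RootDecomp1KDarkResultant

/-!
# RootDecomp1KDarkHeights — §19 «DarkCarving» port, part 2/4 (lens 6, gen 10 = ROUND 5 theorem round of route-Schanuel-RootDecomp1K on A₄ʰ stmt-Schanuel-33363)

Mechanical port (census-1 gen 8; tools tools/build_dark.py over census/tools/gen7/portkit2.py) of §19 of HOME/decomp-schanuel-lens-6/g10/DarkCarving.lean
(sha256 8f91770b…, 9205 l; critic VERDICT 2026-08-30T15:10:09Z ACCEPTED — THEOREM ROUND, PATH T, census C-2) on top of the §17 wave Theorems/RootDecomp1KHyper01…19.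
This part: node lines 8294–8516 (13 declarations: relLen, relLen_nonneg, mahlerMeasure_conjFactor_le, mahlerMeasure_resPoly_le, exists_root_int_pow_le, natDegree_conjFactor_eq …).
The node-local named fact `NW1996Thm1` is replaced by the registered Literature fact
`Literature.NumberTheory.Transcendental.NesterenkoWaldschmidt1996_thm_1` (token-identical body); statements and proofs
are otherwise the node's verbatim, in the wave namespace `Summit.Schanuel.Schanuel.Theorems.RootDecomp1KHyper` (sub-namespace `HyperCell`).
`--supports stmt-Schanuel-33363` (A₄ʰ HyperLiouvilleSchanuel: levels n ≤ 2 decided mod NW96 Thm 1 alone). Sorry-free; standard axioms. Nothing here proves Schanuel; rung 0.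
-/

set_option linter.dupNamespace false
set_option linter.unusedSectionVars false

noncomputable section

open Complex IntermediateField Filter Polynomial

namespace Summit.Schanuel.Schanuel.Theorems.RootDecomp1KHyper

variable {n K : ℕ}

namespace HyperCell

variable {n K : ℕ}

/-- §16b. Roots: a root within ‖A(w)‖^{1/N}, Gauss, Mahler: auxiliary statement `one_le_mahlerMeasure_map_of_ne_zero` (lens 6 gen 10 node, ported verbatim). -/
private theorem one_le_mahlerMeasure_map_of_ne_zero {R : ℤ[X]} (hR : R ≠ 0) :
    1 ≤ (R.map (Int.castRingHom ℂ)).mahlerMeasure := by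
  refine one_le_mahlerMeasure_of_one_le_norm_leadingCoeff ?_
  rw [Polynomial.leadingCoeff_map_of_injective (RingHom.injective_int _), eq_intCast,
    Complex.norm_intCast]
  exact_mod_cast Int.one_le_abs (Polynomial.leadingCoeff_ne_zero.mpr hR)

/-- §16b. Roots: a root within ‖A(w)‖^{1/N}, Gauss, Mahler: auxiliary statement `mahlerMeasure_le_of_dvd` (lens 6 gen 10 node, ported verbatim). -/
private theorem mahlerMeasure_le_of_dvd {Q A : ℤ[X]} (hdvd : Q ∣ A) (hA : A ≠ 0) :
    (Q.map (Int.castRingHom ℂ)).mahlerMeasure ≤ (A.map (Int.castRingHom ℂ)).mahlerMeasure := by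
  obtain ⟨R, rfl⟩ := hdvd
  have hR : R ≠ 0 := right_ne_zero_of_mul hA
  rw [Polynomial.map_mul, mahlerMeasure_mul]
  calc (Q.map (Int.castRingHom ℂ)).mahlerMeasure = (Q.map (Int.castRingHom ℂ)).mahlerMeasure * 1 :=
        (mul_one _).symm
    _ ≤ _ := mul_le_mul_of_nonneg_left (one_le_mahlerMeasure_map_of_ne_zero hR)
        (mahlerMeasure_nonneg _)

/-- The total length `L = Σ_k len(G_k)` of the relation. -/
def relLen (G : Fin (K + 1) → ℤ[X]) : ℝ := ∑ k : Fin (K + 1), (len (G k) : ℝ)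

/-- §19b. The resultant eliminating t: an integer polynomial vanishing at α: auxiliary statement `relLen_nonneg` (lens 6 gen 10 node, ported verbatim). -/
theorem relLen_nonneg (G : Fin (K + 1) → ℤ[X]) : 0 ≤ relLen G :=
  Finset.sum_nonneg fun k _ => by exact_mod_cast len_nonneg (G k)

/-- `M(Q(b, ·)) ≤ L · max(1,‖b‖)^N`. -/
theorem mahlerMeasure_conjFactor_le (G : Fin (K + 1) → ℤ[X]) {N : ℕ}
    (hN : ∀ k, (G k).natDegree ≤ N) (b : ℂ) :
    (conjFactor G b).mahlerMeasure ≤ relLen G * max 1 ‖b‖ ^ N := by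
  refine (mahlerMeasure_le_sum_norm_coeff _).trans ?_
  rw [sum_over_range' _ (fun _ => norm_zero) (K + 1)
    (Nat.lt_succ_of_le (natDegree_conjFactor_le G b)), Finset.sum_range, relLen, Finset.sum_mul]
  refine Finset.sum_le_sum fun k _ => ?_
  rw [coeff_conjFactor]
  exact norm_aeval_le_len_mul_pow (G k) (hN k) b

/-- **Mahler measure of the eliminant**: `M(S) ≤ L^{deg f} · M(f)^N`. -/
theorem mahlerMeasure_resPoly_le (f : ℤ[X]) (hf : f ≠ 0) (G : Fin (K + 1) → ℤ[X]) {N : ℕ}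
    (hN : ∀ k, (G k).natDegree ≤ N) :
    ((resPoly f G N).map (Int.castRingHom ℂ)).mahlerMeasure ≤
      relLen G ^ f.natDegree * (f.map (Int.castRingHom ℂ)).mahlerMeasure ^ N := by
  set fC := f.map (Int.castRingHom ℂ) with hfC
  have hfC0 : fC ≠ 0 := (Polynomial.map_ne_zero_iff (RingHom.injective_int _)).mpr hf
  have hcard : Multiset.card fC.roots = f.natDegree := by
    rw [← natDegree_map_eq_of_injective ((Int.castRingHom ℂ).injective_int) f]
    exact splits_iff_card_roots.mp (IsAlgClosed.splits _)
  rw [map_resPoly f G hN, mahlerMeasure_mul, mahlerMeasure_const,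
    prod_mahlerMeasure_eq_mahlerMeasure_prod, Multiset.map_map, norm_pow]
  have h1 : (Multiset.map ((fun p : ℂ[X] => p.mahlerMeasure) ∘ conjFactor G) fC.roots).prod ≤
      (Multiset.map (fun b => relLen G * max 1 ‖b‖ ^ N) fC.roots).prod :=
    Multiset.prod_map_le_prod_map₀ _ _ (fun b _ => mahlerMeasure_nonneg _)
      fun b _ => mahlerMeasure_conjFactor_le G hN b
  have h2 : (Multiset.map (fun b => relLen G * max 1 ‖b‖ ^ N) fC.roots).prod =
      relLen G ^ f.natDegree * (Multiset.map (fun b => max 1 ‖b‖) fC.roots).prod ^ N := by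
    rw [Multiset.prod_map_mul, Multiset.prod_map_pow, Multiset.map_const', Multiset.prod_replicate,
      hcard]
  have hM : fC.mahlerMeasure = ‖fC.leadingCoeff‖ * (Multiset.map (fun b => max 1 ‖b‖) fC.roots).prod :=
    mahlerMeasure_eq_leadingCoeff_mul_prod_roots fC
  rw [hM, mul_pow]
  calc ‖fC.leadingCoeff‖ ^ N * (Multiset.map ((fun p : ℂ[X] => p.mahlerMeasure) ∘ conjFactor G)
          fC.roots).prod
      ≤ ‖fC.leadingCoeff‖ ^ N * (relLen G ^ f.natDegree *
          (Multiset.map (fun b => max 1 ‖b‖) fC.roots).prod ^ N) := by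
        rw [← h2]; exact mul_le_mul_of_nonneg_left h1 (pow_nonneg (norm_nonneg _) _)
    _ = relLen G ^ f.natDegree * (‖fC.leadingCoeff‖ ^ N *
          (Multiset.map (fun b => max 1 ‖b‖) fC.roots).prod ^ N) := by ring

/-- A non-constant integer polynomial has a root `β` with `‖w − β‖^{deg P} ≤ ‖P(w)‖`. -/
theorem exists_root_int_pow_le (P : ℤ[X]) (hP : 0 < P.natDegree) (w : ℂ) :
    ∃ β : ℂ, aeval β P = 0 ∧ ‖w - β‖ ^ P.natDegree ≤ ‖aeval w P‖ := by
  have hP0 : P ≠ 0 := by rintro rfl; simp at hP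
  have hlead : 1 ≤ ‖(P.map (Int.castRingHom ℂ)).leadingCoeff‖ := by
    rw [Polynomial.leadingCoeff_map_of_injective (RingHom.injective_int _), eq_intCast,
      Complex.norm_intCast]
    exact_mod_cast Int.one_le_abs (Polynomial.leadingCoeff_ne_zero.mpr hP0)
  have hdeg : (P.map (Int.castRingHom ℂ)).natDegree = P.natDegree :=
    natDegree_map_eq_of_injective (RingHom.injective_int _) P
  obtain ⟨β, hβ, hle⟩ := exists_root_pow_le_norm_eval _ hlead (by rw [hdeg]; exact hP) w
  refine ⟨β, ?_, ?_⟩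
  · rw [aeval_def, algebraMap_int_eq, ← eval_map]; exact hβ
  · rw [hdeg, eval_map, ← algebraMap_int_eq, ← aeval_def] at hle; exact hle

/-- §19c. Closeness: a root of P near t, a root of Q(β, ·) near e^t: auxiliary statement `natDegree_conjFactor_eq` (lens 6 gen 10 node, ported verbatim). -/
theorem natDegree_conjFactor_eq (G : Fin (K + 1) → ℤ[X]) {b : ℂ}
    (hb : aeval b (G (Fin.last K)) ≠ 0) : (conjFactor G b).natDegree = K := by
  refine le_antisymm (natDegree_conjFactor_le G b) ?_
  refine le_natDegree_of_ne_zero ?_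
  have := coeff_conjFactor G b (Fin.last K)
  rw [Fin.val_last] at this
  rw [this]; exact hb

/-- §19c. Closeness: a root of P near t, a root of Q(β, ·) near e^t: auxiliary statement `leadingCoeff_conjFactor` (lens 6 gen 10 node, ported verbatim). -/
theorem leadingCoeff_conjFactor (G : Fin (K + 1) → ℤ[X]) {b : ℂ}
    (hb : aeval b (G (Fin.last K)) ≠ 0) : (conjFactor G b).leadingCoeff = aeval b (G (Fin.last K)) := by
  rw [leadingCoeff, natDegree_conjFactor_eq G hb]
  have := coeff_conjFactor G b (Fin.last K)
  rwa [Fin.val_last] at this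

/-- `Q(β, ·)` has a root `α` with `‖G_K(β)‖ · ‖w − α‖^K ≤ ‖Q(β, w)‖`. -/
theorem exists_root_conjFactor_pow_le (G : Fin (K + 1) → ℤ[X]) (hK : 0 < K) {β : ℂ}
    (hβ : aeval β (G (Fin.last K)) ≠ 0) (w : ℂ) :
    ∃ α : ℂ, (conjFactor G β).eval α = 0 ∧
      ‖aeval β (G (Fin.last K))‖ * ‖w - α‖ ^ K ≤ ‖(conjFactor G β).eval w‖ := by
  set c := aeval β (G (Fin.last K)) with hc
  set A : ℂ[X] := C c⁻¹ * conjFactor G β with hA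
  have hc0 : c ≠ 0 := hβ
  have hAdeg : A.natDegree = K := by
    rw [hA, natDegree_C_mul (inv_ne_zero hc0), natDegree_conjFactor_eq G hβ]
  have hAlead : A.leadingCoeff = 1 := by
    rw [hA, leadingCoeff_C_mul_of_isUnit (isUnit_iff_ne_zero.mpr (inv_ne_zero hc0)),
      leadingCoeff_conjFactor G hβ, ← hc, inv_mul_cancel₀ hc0]
  obtain ⟨α, hαroot, hle⟩ := exists_root_pow_le_norm_eval A (by rw [hAlead, norm_one])
    (by rw [hAdeg]; exact hK) w
  refine ⟨α, ?_, ?_⟩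
  · have : A.eval α = 0 := hαroot
    rw [hA, eval_mul, eval_C, mul_eq_zero] at this
    rcases this with h | h
    · exact absurd h (inv_ne_zero hc0)
    · exact h
  · rw [hAdeg, hA, eval_mul, eval_C, norm_mul, norm_inv] at hle
    have hcpos : 0 < ‖c‖ := norm_pos_iff.mpr hc0
    calc ‖c‖ * ‖w - α‖ ^ K ≤ ‖c‖ * (‖c‖⁻¹ * ‖(conjFactor G β).eval w‖) :=
          mul_le_mul_of_nonneg_left hle (norm_nonneg _)
      _ = ‖(conjFactor G β).eval w‖ := by field_simp

/-- The relation polynomial in `t` for fixed second argument `y`: `Q(β, y) = (sliceAt G y)(β)`;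
`Q(t, e^t) = 0` is `(sliceAt G (e^t)).eval t = 0`. -/
theorem eval_conjFactor_eq_eval_sliceAt (G : Fin (K + 1) → ℤ[X]) (b y : ℂ) :
    (conjFactor G b).eval y = (sliceAt G y).eval b := by
  rw [eval_conjFactor, eval_sliceAt]

/-- §19c. Closeness: a root of P near t, a root of Q(β, ·) near e^t: auxiliary statement `eval_map_int` (lens 6 gen 10 node, ported verbatim). -/
theorem eval_map_int (p : ℤ[X]) (z : ℂ) : (p.map (Int.castRingHom ℂ)).eval z = aeval z p := by
  rw [eval_map, ← algebraMap_int_eq, ← aeval_def]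

open Literature.NumberTheory.Transcendental in
/-- §19d. Degrees and heights of the pair (α, β): auxiliary statement `isAlgebraic_of_aeval_int` (lens 6 gen 10 node, ported verbatim). -/
theorem isAlgebraic_of_aeval_int {S : ℤ[X]} (hS : S ≠ 0) {α : ℂ} (hα : aeval α S = 0) :
    IsAlgebraic ℚ α := by
  refine ⟨S.map (Int.castRingHom ℚ),
    (Polynomial.map_ne_zero_iff (Int.castRingHom ℚ).injective_int).mpr hS, ?_⟩
  rw [← algebraMap_int_eq, aeval_map_algebraMap]; exact hα

open Literature.NumberTheory.Transcendental in
/-- **Pair data.** For `β` a root of an irreducible `f ∈ ℤ[X]` and `α` a root of `S ∈ ℤ[X] ∖ 0`: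
`α, β` are algebraic, `1 ≤ [ℚ(α,β):ℚ] ≤ deg S · deg f`, `h(α) ≤ log M(S)`, `h(β) ≤ log M(f)`
(heights in `ℚ(α, β)`). -/
theorem pair_bounds (f : ℤ[X]) (hfirr : Irreducible f) (hfdeg : 0 < f.natDegree) {β : ℂ}
    (hβ : aeval β f = 0) (S : ℤ[X]) (hS : S ≠ 0) {α : ℂ} (hα : aeval α S = 0) :
    IsAlgebraic ℚ α ∧ IsAlgebraic ℚ β ∧
      1 ≤ Module.finrank ℚ (IntermediateField.adjoin ℚ ({α, β} : Set ℂ)) ∧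
      Module.finrank ℚ (IntermediateField.adjoin ℚ ({α, β} : Set ℂ)) ≤ S.natDegree * f.natDegree ∧
      weilHeight₁ (IntermediateField.adjoin ℚ ({α, β} : Set ℂ)) (fun _ : Unit => α) ≤
        Real.log ((S.map (Int.castRingHom ℂ)).mahlerMeasure) ∧
      weilHeight₁ (IntermediateField.adjoin ℚ ({α, β} : Set ℂ)) (fun _ : Unit => β) ≤
        Real.log ((f.map (Int.castRingHom ℂ)).mahlerMeasure) := by
  have hf0 : f ≠ 0 := hfirr.ne_zero
  have hαalg : IsAlgebraic ℚ α := isAlgebraic_of_aeval_int hS hα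
  have hβalg : IsAlgebraic ℚ β := isAlgebraic_of_aeval_int hf0 hβ
  have hαint : IsIntegral ℚ α := isAlgebraic_iff_isIntegral.mp hαalg
  have hβint : IsIntegral ℚ β := isAlgebraic_iff_isIntegral.mp hβalg
  set F := IntermediateField.adjoin ℚ ({α, β} : Set ℂ) with hF
  haveI hfin : FiniteDimensional ℚ F := IntermediateField.finiteDimensional_adjoin_pair hαint hβint
  have hαF : α ∈ F := IntermediateField.subset_adjoin ℚ _ (Set.mem_insert α _)
  have hβF : β ∈ F :=
    IntermediateField.subset_adjoin ℚ _ (Set.mem_insert_of_mem α (Set.mem_singleton β))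
  -- an irreducible integer polynomial of `α`, dividing `S`
  obtain ⟨g, hgirr, hgdeg, hgα⟩ := NesterenkoWaldschmidt1996.exists_irreducible_int_aeval_eq_zero hαalg
  have hgS : g ∣ S := dvd_of_irreducible_of_common_root hgirr hgdeg hgα hα
  have hMg1 : 1 ≤ (g.map (Int.castRingHom ℂ)).mahlerMeasure := one_le_mahlerMeasure_map_of_ne_zero hgirr.ne_zero
  have hMf1 : 1 ≤ (f.map (Int.castRingHom ℂ)).mahlerMeasure := one_le_mahlerMeasure_map_of_ne_zero hf0
  refine ⟨hαalg, hβalg, ?_, ?_, ?_, ?_⟩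
  · exact Module.finrank_pos
  · have e : F = IntermediateField.adjoin ℚ ({α} : Set ℂ) ⊔ IntermediateField.adjoin ℚ ({β} : Set ℂ) := by
      rw [hF, ← Set.singleton_union, IntermediateField.adjoin_union]
    rw [e]
    refine (IntermediateField.finrank_sup_le _ _).trans ?_
    rw [NesterenkoWaldschmidt1996.finrank_adjoin_eq_natDegree hgirr hgdeg hgα,
      NesterenkoWaldschmidt1996.finrank_adjoin_eq_natDegree hfirr hfdeg hβ]
    exact Nat.mul_le_mul_right _ (natDegree_le_of_dvd hgS hS)
  · calc weilHeight₁ F (fun _ : Unit => α)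
        ≤ Real.log (g.map (Int.castRingHom ℂ)).mahlerMeasure / g.natDegree :=
          RoyWaldschmidt1997.MahlerWeil.weilHeight₁_root_le g hgirr hgdeg hgα F hαF
      _ ≤ Real.log (g.map (Int.castRingHom ℂ)).mahlerMeasure :=
          div_le_self (Real.log_nonneg hMg1) (by exact_mod_cast hgdeg)
      _ ≤ Real.log (S.map (Int.castRingHom ℂ)).mahlerMeasure :=
          Real.log_le_log (by linarith) (mahlerMeasure_le_of_dvd hgS hS)
  · calc weilHeight₁ F (fun _ : Unit => β)
        ≤ Real.log (f.map (Int.castRingHom ℂ)).mahlerMeasure / f.natDegree :=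
          RoyWaldschmidt1997.MahlerWeil.weilHeight₁_root_le f hfirr hfdeg hβ F hβF
      _ ≤ Real.log (f.map (Int.castRingHom ℂ)).mahlerMeasure :=
          div_le_self (Real.log_nonneg hMf1) (by exact_mod_cast hfdeg)

open Literature.NumberTheory.Transcendental in
/-- §19e. The weak measure at exponential-algebraic points from NW 1996, Theorem 1: auxiliary statement `one_le_relLen` (lens 6 gen 10 node, ported verbatim). -/
theorem one_le_relLen (G : Fin (K + 1) → ℤ[X]) (hGK : G (Fin.last K) ≠ 0) : 1 ≤ relLen G := by
  have h1 : (1 : ℝ) ≤ (len (G (Fin.last K)) : ℝ) := by exact_mod_cast one_le_len hGK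
  refine h1.trans ?_
  exact Finset.single_le_sum (f := fun k => (len (G k) : ℝ))
    (fun k _ => by exact_mod_cast len_nonneg (G k)) (Finset.mem_univ (Fin.last K))

end HyperCell

end Summit.Schanuel.Schanuel.Theorems.RootDecomp1KHyper
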